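import Summits.NavierStokesRegularity.NavierStokesRegularity.Theses.PalasekTowerBreakdown
import Summits.NavierStokesRegularity.FluidComputer.PalasekTowerBurgersOneShot

/-!
# `EpisodeBase` BY NAME: the witness stage is not a one-shot Burgers hand-over at its anchor
# (crux idea `orthogonal-seed-contact-strain` (1), stmt-NavierStokesRegularity-19179)

Cell `ns-blowup`, seat `ns-palasek-19179-p2` (g3; holder of record of the crux `EpisodeBase` of the route
`PalasekTowerBreakdown`, item stmt-NavierStokesRegularity-19179, line `slot` v5). Route-side reading of
`FluidComputer/PalasekTowerBurgersOneShot.lean` (p483636; the ONE-SHOT BUDGET IDENTITY of the crux idea card, mechcritic-2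
USE-1, 19179 evidence #58/#60): for the route's register (`TowerRates.wide`, `Margins.routeG`, `ν = 1`) no registered stage's
`τ₀`-slice coincides, at the probe point `x₀ + P` (`P = (2γ^{−1/2}, 0, 0)`), with a translated Burgers vortex whose axis
gradient already meets the level-1 strain floor `A₁` in a host strain `γ ≤ (7/5)A₀` — the GLOBAL ANCHOR caps every speed at
`τ₀` by `Y₀` while the model carries `> Y₀` there. In particular the level-1 stage witnessing `EpisodeBase` is not such a
configuration: the base episode must make its strain inside the first window (the TIMING side of HOLDER-CENSUS-19179 §5(b)).

* `palasekTowerBreakdown_stage_ne_burgersChild_at_anchor` — every registered stage, every level `k`;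
* `palasekTowerBreakdown_episodeBase_witness_ne_burgersChild_at_anchor` — `EpisodeBase` ⇒ its witness schedule/stage obey it.

LABEL: E–C typing (KERNEL, proofs only, by name; MODEL-side: the Burgers vortex is the model of a «child tube in a coherent
strain»). WHAT THIS IS NOT: not Navier–Stokes evidence — nothing about any flow's dynamics, `RungG 1` or blow-up; HELPER for
19179 (`--supports`), closes nothing.

References: S. Palasek, arXiv:2605.13827 §3.3 [cite: Palasek2026ElementaryModel, §3.3]; P. G. Saffman, *Vortex Dynamics*
(1992) §13.3 [cite: Saffman1992, §13.3 eqs. (9), (12)].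
-/

noncomputable section

-- `Summit.<Summit>.<Problem>` is the tree's mandated summit-side namespace (CONVENTIONS §2); for this
-- single-conjunct summit the two coincide, so the duplicate is deliberate.
set_option linter.dupNamespace false

namespace Summit.NavierStokesRegularity.NavierStokesRegularity.Theorems

open Literature.Analysis.FluidPDE
open Summit.NavierStokesRegularity.FluidComputer.PalasekTowerClayBridge
open Summit.NavierStokesRegularity.FluidComputer.PalasekTowerClayBridge.BurgersOneShot

/-- **No registered stage is a one-shot Burgers hand-over at its anchor** (route register: wide rates, `Margins.routeG`,
`ν = 1`; every level `k`): if `0 < γ ≤ (7/5)A₀` and the Burgers vortex `burgersVortex γ 1 Γ` meets the level-1 strain floor on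
its axis (`A₁ ≤ ‖Du(0)‖`), then for every centre `x₀` the stage's `τ₀`-slice differs from the translated model at `x₀ + P`.
[cite: Palasek2026ElementaryModel, §3.3] -/
theorem palasekTowerBreakdown_stage_ne_burgersChild_at_anchor {S : Schedule TowerRates.wide} {k : ℕ}
    (s : Stage 1 TowerRates.wide S (Margins.routeG TowerRates.wide) k) (x₀ : EuclideanSpace ℝ (Fin 3)) {γ Γ : ℝ}
    (hγ : 0 < γ) (hγA : γ ≤ 7 / 5 * TowerRates.wide.A 0)
    (hA : TowerRates.wide.A 1 ≤ ‖fderiv ℝ (burgersVortex γ 1 Γ) 0‖) :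
    s.u (S.τ 0) (x₀ + twoCorePoint γ 1) ≠ burgersVortex γ 1 Γ (twoCorePoint γ 1) :=
  BurgersOneShot.Stage.ne_burgersVortex_at_anchor s x₀ hγ hγA hA

/-- **`EpisodeBase` BY NAME**: the schedule and level-1 stage witnessing the crux are pinned, rigid, quiet, and the stage's
`τ₀`-slice is NOT a one-shot Burgers hand-over at its anchor — for every centre `x₀`, every host strain `0 < γ ≤ (7/5)A₀` and
every circulation `Γ` with `A₁ ≤ ‖D(burgersVortex γ 1 Γ)(0)‖`, the slice differs from the translated model at `x₀ + P`.
[cite: Palasek2026ElementaryModel, §3.3] -/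
theorem palasekTowerBreakdown_episodeBase_witness_ne_burgersChild_at_anchor
    (h : Summit.NavierStokesRegularity.NavierStokesRegularity.Theses.PalasekTowerBreakdown.EpisodeBase) :
    ∃ S : Schedule TowerRates.wide, S.Pins 8 (6 / 5) ∧ S.Rigid ∧ S.Quiet ∧
      ∃ s : Stage 1 TowerRates.wide S (Margins.routeG TowerRates.wide) 1,
        ∀ (x₀ : EuclideanSpace ℝ (Fin 3)) (γ Γ : ℝ), 0 < γ → γ ≤ 7 / 5 * TowerRates.wide.A 0 →
          TowerRates.wide.A 1 ≤ ‖fderiv ℝ (burgersVortex γ 1 Γ) 0‖ →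
            s.u (S.τ 0) (x₀ + twoCorePoint γ 1) ≠ burgersVortex γ 1 Γ (twoCorePoint γ 1) := by
  obtain ⟨S, hP, hR, hQ, ⟨s⟩⟩ := h
  exact ⟨S, hP, hR, hQ, s, fun x₀ _ _ hγ hγA hA =>
    palasekTowerBreakdown_stage_ne_burgersChild_at_anchor s x₀ hγ hγA hA⟩

/-- **The speed number behind it, by name**: under the same hypotheses the model's speed at `P` exceeds the register's level-0
anchor value `Y₀` (`> 1380` in fact: `‖u(P)‖² ≥ (316/125)(A₁ − (7/5)A₀) > 1.906·10⁶`). [cite: Palasek2026ElementaryModel, §3.3] -/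
theorem palasekTowerBreakdown_Y_zero_lt_oneShot_speed {γ Γ : ℝ} (hγ : 0 < γ)
    (hγA : γ ≤ 7 / 5 * TowerRates.wide.A 0) (hA : TowerRates.wide.A 1 ≤ ‖fderiv ℝ (burgersVortex γ 1 Γ) 0‖) :
    TowerRates.wide.Y 0 < ‖burgersVortex γ 1 Γ (twoCorePoint γ 1)‖ :=
  oneShot_speed_gt_Y_zero hγ hγA hA

end Summit.NavierStokesRegularity.NavierStokesRegularity.Theorems

end
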